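import Summits.Ventures.PercRepro.RankLevelSetNormSkewConv
import Summits.Ventures.PercRepro.RankLevelSetMinorPairSkewTruncate
import Summits.Ventures.PercRepro.RankLevelSetBiIndepContainHalfPaving
import Summits.Ventures.PercRepro.RankLevelSetBiIndepContainSkewUniform
import Summits.Ventures.PercRepro.RankLevelSetBiIndepContainNorm

/-! # RankLevelSetMinorPairNormSkew — THE NORMALIZED HALF RULE ON CONTAIN-SETS (NHR): ADDITIVE UNDER DIRECT SUMS,
CLOSED UNDER TRUNCATION, SATISFIED BY EVERY PAVING MATROID; HENCE (CUM-norm) ON THE WHOLE SUM-AND-TRUNCATION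
CLOSURE OF THE PAVING MATROIDS, THE MODEL FAMILY INCLUDED (night-1 g31; dossier §43)

`MinorPairNormSkew M Y₁ Y₂ N` is the normalized cumulative skew `SkewConv.NormSkew (minorPairCount M Y₁ Y₂) N` of the
mixed profile of g29; on a contain-set (`Y₂ = ∅`, profile `α^X_{c+i}`, `c = #X`) with `N = #E − 2c` it is THE
NORMALIZED HALF RULE (NHR): `α^X_{c+i} / C(#E − 2c, i) ≤ α^X_{c+j} / C(#E − 2c, j)` for `i < j`, `i + j ≤ #E − 2c`
— skewed right about `(#E − 2c)/2`, half a step more than (CUM-norm) asks (`BiContainNormHalf M`, a `Prop`).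
* **`biContainNormSkew_of_normHalf`**: NHR ⟹ (CUM-norm) (the comparisons of (CUM-norm) are among those of NHR).
* **`minorPairNormSkew_disjointSum`**: the normalized skew is additive under direct sums with any split signature
  (`SkewConv.normSkew_conv`, the profile of the sum being the convolution `minorPairCount_disjointSum`);
  **`biContainNormHalf_disjointSum`**: NHR is ⊕-closed (the parameters `(#E_M − 2#X_M) + (#E_N − 2#X_N)` add to
  `#E − 2#X`, `normSkew_mono` absorbing the ℕ-truncation).
* **`biContainNormHalf_truncateTo`**: NHR survives every truncation `T_k M` (the window `#E − k ≤ level ≤ k` is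
  symmetric about `#E/2`: a cut upper level forces a cut lower level, as in `minorPairSkew_contain_truncateTo`).
* **`biContainNormHalf_of_paving`**: every paving matroid satisfies NHR — the interior levels are full binomial rows
  and the ratio `C(#E − c, j)/C(#E − 2c, j)` grows with `j` (`chooseRatio_le`); the extreme pair `(#E − r, r)` has
  equal normalizations and is the paving basis inequality `ncard_bases_disjoint_le_of_paving` of g30.
* COROLLARIES: **`biContainNormSkew_disjointSum_of_normHalf`** ((CUM-norm) on a direct sum of two NHR matroids),
  **`biContainNormHalf_modelMatroid`** / **`biContainNormSkew_modelMatroid`**: the whole model family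
  `T_p(U_{q,F} ⊕ U_{D,D})` satisfies NHR and (CUM-norm) with every contain-set — g30's successor item (1).
Nothing here asserts (CUM-norm) in general; every declaration has a docstring; imports: the cell's own modules and
Mathlib only. Axioms: standard. -/

namespace PercRepro

open Set Matroid

variable {α : Type}

/-! ## The normalized skew of a mixed profile -/

/-- **The normalized cumulative skew of the mixed profile** `p_i(Y₁, Y₂)` with parameter `N`:
`p_i · C(N, j) ≤ p_j · C(N, i)` for `i < j`, `i + j ≤ N`. -/
def MinorPairNormSkew (M : Matroid α) (Y₁ Y₂ : Set α) (N : ℕ) : Prop :=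
  SkewConv.NormSkew (minorPairCount M Y₁ Y₂) N

/-- The normalized skew is monotone in the parameter. -/
lemma minorPairNormSkew_mono (M : Matroid α) {Y₁ Y₂ : Set α} {N N' : ℕ} (h : MinorPairNormSkew M Y₁ Y₂ N)
    (hN : N' ≤ N) : MinorPairNormSkew M Y₁ Y₂ N' :=
  SkewConv.normSkew_mono h hN

/-- The normalized skew implies the cumulative skew of g29. -/
lemma minorPairSkew_of_normSkew (M : Matroid α) {Y₁ Y₂ : Set α} {N : ℕ} (h : MinorPairNormSkew M Y₁ Y₂ N) :
    MinorPairSkew M Y₁ Y₂ N :=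
  SkewConv.normSkew_skew h

/-- **THE NORMALIZED HALF RULE (NHR)** on every contain-set (a `Prop`, NOT asserted in general): for every
`X ⊆ E`, `MinorPairNormSkew M X ∅ (#E − 2#X)`, i.e. `α^X_{c+i} · C(#E − 2c, j) ≤ α^X_{c+j} · C(#E − 2c, i)` for
`i < j`, `i + j ≤ #E − 2c`. -/
def BiContainNormHalf (M : Matroid α) : Prop :=
  ∀ X ⊆ M.E, MinorPairNormSkew M X ∅ (M.E.ncard - 2 * X.ncard)

variable (M : Matroid α) [M.Finite]

/-- **NHR implies (CUM-norm)**: the comparisons `i + j + 1 ≤ #E − 2#X` are among those of NHR. -/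
theorem biContainNormSkew_of_normHalf (h : BiContainNormHalf M) : BiContainNormSkew M := by
  intro X hX i j hij hR
  have hXE : X.ncard ≤ M.E.ncard := Set.ncard_le_ncard hX M.ground_finite
  have hi := biContainCount_eq_minorPairCount M hX (k := X.ncard + i) (by omega)
  have hj := biContainCount_eq_minorPairCount M hX (k := X.ncard + j) (by omega)
  rw [Nat.add_sub_cancel_left] at hi hj
  rw [hi, hj]
  exact h X hX i j hij (by omega)

omit [M.Finite] in
/-- **NHR implies the half rule of g30** on every contain-set. -/
theorem minorPairSkew_half_of_normHalf (h : BiContainNormHalf M) :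
    ∀ X ⊆ M.E, MinorPairSkew M X ∅ (M.E.ncard - 2 * X.ncard) :=
  fun X hX => minorPairSkew_of_normSkew M (h X hX)

/-! ## Direct sums -/

section Sum

variable {M} {N : Matroid α} [N.Finite] {h : Disjoint M.E N.E}

/-- **THE NORMALIZED SKEW IS ADDITIVE UNDER DIRECT SUMS WITH A SPLIT SIGNATURE**:
`MinorPairNormSkew M A₁ B₁ N₁ → MinorPairNormSkew N A₂ B₂ N₂ →`
`MinorPairNormSkew (M ⊕ N) (A₁ ∪ A₂) (B₁ ∪ B₂) (N₁ + N₂)`. -/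
theorem minorPairNormSkew_disjointSum {A₁ B₁ A₂ B₂ : Set α} (hA₁ : A₁ ⊆ M.E) (hB₁ : B₁ ⊆ M.E)
    (hA₂ : A₂ ⊆ N.E) (hB₂ : B₂ ⊆ N.E) (hd₁ : Disjoint A₁ B₁) (hd₂ : Disjoint A₂ B₂) {N₁ N₂ : ℕ}
    (h₁ : MinorPairNormSkew M A₁ B₁ N₁) (h₂ : MinorPairNormSkew N A₂ B₂ N₂) :
    MinorPairNormSkew (M.disjointSum N h) (A₁ ∪ A₂) (B₁ ∪ B₂) (N₁ + N₂) := by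
  unfold MinorPairNormSkew at h₁ h₂ ⊢
  refine SkewConv.normSkew_congr (SkewConv.normSkew_conv h₁ h₂) fun k _ => ?_
  rw [minorPairCount_disjointSum hA₁ hB₁ hA₂ hB₂ hd₁ hd₂ k]
  rfl

/-- **NHR IS CLOSED UNDER DIRECT SUMS**: `BiContainNormHalf M → BiContainNormHalf N →`
`BiContainNormHalf (M ⊕ N)`. -/
theorem biContainNormHalf_disjointSum (hM : BiContainNormHalf M) (hN : BiContainNormHalf N) :
    BiContainNormHalf (M.disjointSum N h) := by
  intro X hX
  have hsplit := eq_union_inter_of_subset_disjointSum hX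
  have hcard := ncard_inter_add_ncard_inter hX
  have hn := ncard_ground_disjointSum (M := M) (N := N) (h := h)
  have key := minorPairNormSkew_disjointSum (h := h) Set.inter_subset_right (Set.empty_subset _)
    Set.inter_subset_right (Set.empty_subset _) (Set.disjoint_empty _) (Set.disjoint_empty _)
    (hM (X ∩ M.E) Set.inter_subset_right) (hN (X ∩ N.E) Set.inter_subset_right)
  rw [Set.union_empty, ← hsplit] at key
  refine minorPairNormSkew_mono _ key ?_
  omega

/-- **(CUM-norm) on a direct sum of two NHR matroids.** -/
theorem biContainNormSkew_disjointSum_of_normHalf (hM : BiContainNormHalf M) (hN : BiContainNormHalf N) :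
    haveI : (M.disjointSum N h).Finite := ⟨by
      rw [Matroid.disjointSum_ground_eq]; exact M.ground_finite.union N.ground_finite⟩
    BiContainNormSkew (M.disjointSum N h) :=
  haveI : (M.disjointSum N h).Finite := ⟨by
    rw [Matroid.disjointSum_ground_eq]; exact M.ground_finite.union N.ground_finite⟩
  biContainNormSkew_of_normHalf _ (biContainNormHalf_disjointSum hM hN)

end Sum

/-! ## Truncation -/

/-- **NHR SURVIVES TRUNCATION**: `BiContainNormHalf M → BiContainNormHalf (T_k M)`. -/
theorem biContainNormHalf_truncateTo (h : BiContainNormHalf M) (k : ℕ) :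
    haveI := truncateTo_finite M k
    BiContainNormHalf (truncateTo M k) := by
  haveI := truncateTo_finite M k
  intro X hX i j hij hR
  rw [truncateTo_E] at hX hR ⊢
  rw [minorPairCount_truncateTo M hX k i, minorPairCount_truncateTo M hX k j]
  split_ifs with hi hj hj
  · exact h X hX i j hij hR
  · exfalso
    omega
  · rw [Nat.zero_mul]
    exact Nat.zero_le _
  · rw [Nat.zero_mul]
    exact Nat.zero_le _

/-! ## Paving matroids -/

/-- **EVERY PAVING MATROID SATISFIES NHR**: `Paving M → BiContainNormHalf M`. Interior target levels are full
binomial rows and `C(#E − c, j)/C(#E − 2c, j)` grows with `j`; the extreme pair `(#E − r, r)` has equal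
normalizations and is the paving basis inequality. -/
theorem biContainNormHalf_of_paving (h : Paving M) : BiContainNormHalf M := by
  intro X hX i j hij hR
  obtain ⟨r, hr⟩ : ∃ r : ℕ, M.eRank = r := by
    have := exists_eRk_eq_coe M M.E
    rwa [M.eRk_ground] at this
  have hXE : X.ncard ≤ M.E.ncard := Set.ncard_le_ncard hX M.ground_finite
  have hi := biContainCount_eq_minorPairCount M hX (k := i + X.ncard) (by omega)
  have hj := biContainCount_eq_minorPairCount M hX (k := j + X.ncard) (by omega)
  rw [Nat.add_sub_cancel] at hi hj
  rw [← hi, ← hj]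
  set k := i + X.ncard with hk
  set k' := j + X.ncard with hk'
  by_cases hzero : biContainCount M X k = 0
  · rw [hzero, Nat.zero_mul]
    exact Nat.zero_le _
  obtain ⟨hck, hrank⟩ := of_biContainCount_ne_zero M hzero
  rw [hr] at hrank
  have hrank' : M.E.ncard - k ≤ r := by exact_mod_cast hrank
  have hk'E : k' ≤ M.E.ncard := by omega
  by_cases htop : k' < r
  · -- interior target level: the full binomial row, and the ratio lemma
    have hk1 : ((k' : ℕ) : ℕ∞) < M.eRank := by rw [hr]; exact_mod_cast htop
    have hk2 : ((M.E.ncard - k' : ℕ) : ℕ∞) < M.eRank := by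
      rw [hr]; exact_mod_cast (show M.E.ncard - k' < r by omega)
    have hfull := biContainCount_eq_choose_of_paving M h hX (by omega) hk1 hk2
    have hle := biContainCount_le_choose M hX hck
    rw [hfull, hk', Nat.add_sub_cancel]
    rw [hk, Nat.add_sub_cancel] at hle
    calc biContainCount M X k * (M.E.ncard - 2 * X.ncard).choose j
        ≤ (M.E.ncard - X.ncard).choose i * (M.E.ncard - 2 * X.ncard).choose j := Nat.mul_le_mul_right _ hle
      _ ≤ (M.E.ncard - X.ncard).choose j * (M.E.ncard - 2 * X.ncard).choose i :=
          SkewConv.chooseRatio_le (by omega) hij.le (by omega)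
  · -- the top level `k' = r`, the bottom level `k = #E − r`: equal normalizations, the basis inequality
    push Not at htop
    have hk'r : k' = r := by omega
    have hkb : k = M.E.ncard - r := by omega
    have hsum : i + j = M.E.ncard - 2 * X.ncard := by omega
    have hsym : (M.E.ncard - 2 * X.ncard).choose j = (M.E.ncard - 2 * X.ncard).choose i := by
      rw [← hsum, Nat.choose_symm_add]
    rw [hsym]
    apply Nat.mul_le_mul_right
    by_cases hn : M.E.ncard < 2 * r
    · rw [hk'r, hkb, biContainCount_bottom_of_paving M h hr hn (by omega) hX,
        biContainCount_top_of_paving M h hr hn hX]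
      exact ncard_bases_disjoint_le_of_paving M h hr hn hX
    · exfalso
      omega

/-- **Every paving matroid satisfies (CUM-norm)** — through NHR (a second route to g30's
`biContainNormSkew_of_paving`). -/
theorem biContainNormSkew_of_paving_normHalf (h : Paving M) : BiContainNormSkew M :=
  biContainNormSkew_of_normHalf M (biContainNormHalf_of_paving M h)

/-! ## The model family -/

/-- **THE MODEL FAMILY SATISFIES NHR ON EVERY CONTAIN-SET**: `T_p(U_{q,F} ⊕ U_{D,D})` is the truncation of a
direct sum of two uniform (paving) matroids. -/
theorem biContainNormHalf_modelMatroid {E : Set α} (hE : E.Finite) {F : Set α} (hF : F ⊆ E) (q p : ℕ) :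
    haveI := modelMatroid_finite hE F q p
    BiContainNormHalf (modelMatroid hE F q p) := by
  haveI := modelMatroid_finite hE F q p
  haveI := modelMatroid_finite (hE.subset hF) ∅ q q
  haveI := modelMatroid_finite ((hE.subset (Set.sdiff_subset : E \ F ⊆ E))) ∅ (E \ F).ncard (E \ F).ncard
  set N := (modelMatroid (hE.subset hF) ∅ q q).disjointSum
    (modelMatroid ((hE.subset (Set.sdiff_subset : E \ F ⊆ E))) ∅ (E \ F).ncard (E \ F).ncard)
    Set.disjoint_sdiff_right with hN
  haveI : N.Finite := ⟨by
    rw [hN, Matroid.disjointSum_ground_eq, modelMatroid_E, modelMatroid_E]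
    exact (hE.subset hF).union ((hE.subset (Set.sdiff_subset : E \ F ⊆ E)))⟩
  have hhalf : BiContainNormHalf N :=
    biContainNormHalf_disjointSum (biContainNormHalf_of_paving _ (uniform_paving (hE.subset hF) q q))
      (biContainNormHalf_of_paving _ (uniform_paving (hE.subset (Set.sdiff_subset : E \ F ⊆ E)) _ _))
  rw [modelMatroid_eq_truncateTo_disjointSum hE hF q p]
  exact biContainNormHalf_truncateTo N hhalf p

/-- **(CUM-norm) ON THE WHOLE MODEL FAMILY WITH EVERY CONTAIN-SET**: `BiContainNormSkew (modelMatroid hE F q p)`. -/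
theorem biContainNormSkew_modelMatroid {E : Set α} (hE : E.Finite) {F : Set α} (hF : F ⊆ E) (q p : ℕ) :
    haveI := modelMatroid_finite hE F q p
    BiContainNormSkew (modelMatroid hE F q p) :=
  haveI := modelMatroid_finite hE F q p
  biContainNormSkew_of_normHalf _ (biContainNormHalf_modelMatroid hE hF q p)

end PercRepro
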